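import Mathlib
import Summits.Ventures.HodgeRepro.Tier4.Line1.RTFSetting

/-!
# Tier4/Line1/CompactAverage — the two-sided average of a test function over a compact subgroup `K` of the adelic
group (the Haar probability measure `haarK`, `avgR`, `avgL`): bi-`K`-invariant, a test function again, supported in
`K · tsupport f · K`, and within `2η` of `f` in sup norm when `K` is small — the averaging behind LINE L1's F2′
(`IsolatingTestsLevel`), plus the left-translation twin of t4-L1-p2's uniform-continuity lemma

Blind re-derivation cell `pub-hodge-repro`, Tier 4 (README §9–§10), seat t4-L1-p3 (gen 2); planner's cut t4-plan-1 g2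
S13462 (4).  Target tree path `lean/Summits/Ventures/HodgeRepro/Tier4/Line1/CompactAverage.lean`.  Imports LINE L1's
`RTFSetting` (`RTF.IsTest`).  Mathlib: `Measure.haarMeasure` on the compact group `K` (normalised on `⊤`),
`integral_mul_left_eq_self` (LEFT-invariance only — the definitions `avgR f x := ∫_K f (x k)`,
`avgL g x := ∫_K g (k⁻¹ x)` are chosen so that both invariances follow from it), `continuous_of_dominated`
(continuity of the averages, bound `‖f‖_∞`), `Continuous.bounded_above_of_compact_support`.
Nothing here says anything about the status of the Hodge conjecture for CM abelian varieties, which is NOT proved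
(HC_CM is NOT proved by anyone in this repository).
-/

set_option autoImplicit false

noncomputable section

namespace Summit.Ventures.HodgeRepro.Tier4.Line1

namespace RTF

open MeasureTheory Topology Filter
open scoped Pointwise

variable {G : Type} [Group G] [TopologicalSpace G] [IsTopologicalGroup G] [MeasurableSpace G] [BorelSpace G]

/-! ## The two-sided average over a compact subgroup -/

section Average

/-- **The Haar probability measure of a compact subgroup** `K` (Mathlib's `haarMeasure` normalised on `K` itself). -/
def haarK (K : Subgroup G) (hKc : IsCompact (K : Set G)) : Measure K :=
  haveI : CompactSpace K := isCompact_iff_compactSpace.mp hKc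
  haveI : Nonempty K := ⟨1⟩
  Measure.haarMeasure (⊤ : TopologicalSpace.PositiveCompacts K)

/-- `haarK` is a probability measure. -/
theorem haarK_isProbabilityMeasure (K : Subgroup G) (hKc : IsCompact (K : Set G)) :
    IsProbabilityMeasure (haarK K hKc) := by
  haveI : CompactSpace K := isCompact_iff_compactSpace.mp hKc
  haveI : Nonempty K := ⟨1⟩
  constructor
  unfold haarK
  have := @Measure.haarMeasure_self K _ _ _ _ _ (⊤ : TopologicalSpace.PositiveCompacts K)
  simpa using this

/-- `haarK` is left-invariant. -/
theorem haarK_isMulLeftInvariant (K : Subgroup G) (hKc : IsCompact (K : Set G)) :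
    (haarK K hKc).IsMulLeftInvariant := by
  haveI : CompactSpace K := isCompact_iff_compactSpace.mp hKc
  haveI : Nonempty K := ⟨1⟩
  unfold haarK
  infer_instance

/-- **The right average** `(avgR f)(x) = ∫_K f (x k) dk` of `f` over `K`. -/
def avgR (K : Subgroup G) (hKc : IsCompact (K : Set G)) (f : G → ℂ) (x : G) : ℂ :=
  ∫ k : K, f (x * (k : G)) ∂(haarK K hKc)

/-- **The left average** `(avgL g)(x) = ∫_K g (k⁻¹ x) dk` of `g` over `K`. -/
def avgL (K : Subgroup G) (hKc : IsCompact (K : Set G)) (g : G → ℂ) (x : G) : ℂ :=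
  ∫ k : K, g ((k : G)⁻¹ * x) ∂(haarK K hKc)

/-- The right average is right-`K`-invariant (left-invariance of `haarK` under `k ↦ k₀ k`). -/
theorem avgR_right_invariant (K : Subgroup G) (hKc : IsCompact (K : Set G)) (f : G → ℂ) {k₀ : G}
    (hk₀ : k₀ ∈ K) (x : G) : avgR K hKc f (x * k₀) = avgR K hKc f x := by
  haveI := haarK_isMulLeftInvariant K hKc
  unfold avgR
  have := integral_mul_left_eq_self (μ := haarK K hKc) (fun k : K => f (x * (k : G))) ⟨k₀, hk₀⟩
  simp only [Subgroup.coe_mul, ← mul_assoc] at this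
  exact this

/-- The left average is left-`K`-invariant (left-invariance of `haarK` under `k ↦ k₀⁻¹ k`). -/
theorem avgL_left_invariant (K : Subgroup G) (hKc : IsCompact (K : Set G)) (g : G → ℂ) {k₀ : G}
    (hk₀ : k₀ ∈ K) (x : G) : avgL K hKc g (k₀ * x) = avgL K hKc g x := by
  haveI := haarK_isMulLeftInvariant K hKc
  unfold avgL
  have := integral_mul_left_eq_self (μ := haarK K hKc) (fun k : K => g ((k : G)⁻¹ * x)) ⟨k₀, hk₀⟩⁻¹
  simp only [Subgroup.coe_mul, Subgroup.coe_inv, inv_inv, mul_inv_rev] at this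
  simp only [mul_assoc] at this ⊢
  exact this

/-- The left average of a right-`K`-invariant function is right-`K`-invariant. -/
theorem avgL_right_invariant_of (K : Subgroup G) (hKc : IsCompact (K : Set G)) (g : G → ℂ)
    (hg : ∀ k ∈ K, ∀ x, g (x * k) = g x) {k₀ : G} (hk₀ : k₀ ∈ K) (x : G) :
    avgL K hKc g (x * k₀) = avgL K hKc g x := by
  unfold avgL
  congr 1
  funext k
  rw [← mul_assoc, hg k₀ hk₀]

/-- The right average is bounded by a bound of `f`. -/
theorem norm_avgR_le (K : Subgroup G) (hKc : IsCompact (K : Set G)) (f : G → ℂ) {C : ℝ} (hC : ∀ x, ‖f x‖ ≤ C)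
    (x : G) : ‖avgR K hKc f x‖ ≤ C := by
  haveI := haarK_isProbabilityMeasure K hKc
  unfold avgR
  calc ‖∫ k : K, f (x * (k : G)) ∂(haarK K hKc)‖
      ≤ ∫ _k : K, C ∂(haarK K hKc) :=
        norm_integral_le_of_norm_le (integrable_const C) (Eventually.of_forall fun k => hC _)
    _ = C := by simp

/-- The right average of a test function is continuous (dominated convergence). -/
theorem continuous_avgR [FirstCountableTopology G] (K : Subgroup G) (hKc : IsCompact (K : Set G)) {f : G → ℂ}
    (hf : IsTest f) : Continuous (avgR K hKc f) := by
  haveI := haarK_isProbabilityMeasure K hKc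
  obtain ⟨C, hC⟩ := hf.cont.bounded_above_of_compact_support hf.compact
  unfold avgR
  apply continuous_of_dominated (bound := fun _ => C)
  · intro x
    exact (hf.cont.comp (continuous_const.mul continuous_subtype_val)).aestronglyMeasurable
  · intro x
    exact Eventually.of_forall fun k => hC _
  · exact integrable_const C
  · exact Eventually.of_forall fun k => hf.cont.comp (continuous_id.mul continuous_const)

/-- The left average of a bounded continuous function is continuous. -/
theorem continuous_avgL [FirstCountableTopology G] (K : Subgroup G) (hKc : IsCompact (K : Set G)) {g : G → ℂ}
    (hg : Continuous g) (hb : ∃ C, ∀ x, ‖g x‖ ≤ C) : Continuous (avgL K hKc g) := by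
  haveI := haarK_isProbabilityMeasure K hKc
  obtain ⟨C, hC⟩ := hb
  unfold avgL
  apply continuous_of_dominated (bound := fun _ => C)
  · intro x
    exact (hg.comp (continuous_subtype_val.inv.mul continuous_const)).aestronglyMeasurable
  · intro x
    exact Eventually.of_forall fun k => hC _
  · exact integrable_const C
  · exact Eventually.of_forall fun k => hg.comp (continuous_const.mul continuous_id)

/-- The right average vanishes outside `tsupport f · K`. -/
theorem avgR_eq_zero (K : Subgroup G) (hKc : IsCompact (K : Set G)) (f : G → ℂ) {x : G}
    (hx : x ∉ tsupport f * (K : Set G)) : avgR K hKc f x = 0 := by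
  unfold avgR
  apply integral_eq_zero_of_ae
  apply Eventually.of_forall
  intro k
  by_contra h
  apply hx
  have hmem : x * (k : G) ∈ tsupport f := subset_tsupport _ h
  have : x = (x * (k : G)) * ((k : G)⁻¹) := by group
  rw [this]
  exact Set.mul_mem_mul hmem (K.inv_mem k.2)

/-- The left average vanishes outside `K · tsupport g`. -/
theorem avgL_eq_zero (K : Subgroup G) (hKc : IsCompact (K : Set G)) (g : G → ℂ) {x : G}
    (hx : x ∉ (K : Set G) * tsupport g) : avgL K hKc g x = 0 := by
  unfold avgL
  apply integral_eq_zero_of_ae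
  apply Eventually.of_forall
  intro k
  by_contra h
  apply hx
  have hmem : (k : G)⁻¹ * x ∈ tsupport g := subset_tsupport _ h
  have : x = (k : G) * ((k : G)⁻¹ * x) := by group
  rw [this]
  exact Set.mul_mem_mul k.2 hmem

/-- The support of the right average of a test function lies in `tsupport f · K`. -/
theorem tsupport_avgR_subset [T2Space G] (K : Subgroup G) (hKc : IsCompact (K : Set G)) {f : G → ℂ}
    (hf : IsTest f) : tsupport (avgR K hKc f) ⊆ tsupport f * (K : Set G) :=
  closure_minimal (fun x hx => by
      by_contra h
      exact hx (avgR_eq_zero K hKc f h))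
    (hf.compact.mul hKc).isClosed

/-- The support of the left average of a compactly supported function lies in `K · tsupport g`. -/
theorem tsupport_avgL_subset [T2Space G] (K : Subgroup G) (hKc : IsCompact (K : Set G)) {g : G → ℂ}
    (hg : HasCompactSupport g) : tsupport (avgL K hKc g) ⊆ (K : Set G) * tsupport g :=
  closure_minimal (fun x hx => by
      by_contra h
      exact hx (avgL_eq_zero K hKc g h))
    (hKc.mul hg).isClosed

/-- The right average of a test function has compact support. -/
theorem hasCompactSupport_avgR [T2Space G] (K : Subgroup G) (hKc : IsCompact (K : Set G)) {f : G → ℂ}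
    (hf : IsTest f) : HasCompactSupport (avgR K hKc f) :=
  HasCompactSupport.of_support_subset_isCompact (hf.compact.mul hKc)
    ((subset_tsupport _).trans (tsupport_avgR_subset K hKc hf))

/-- **The two-sided average of a test function is a test function.** -/
theorem isTest_avg [FirstCountableTopology G] [T2Space G] (K : Subgroup G) (hKc : IsCompact (K : Set G))
    {f : G → ℂ} (hf : IsTest f) : IsTest (avgL K hKc (avgR K hKc f)) := by
  obtain ⟨C, hC⟩ := hf.cont.bounded_above_of_compact_support hf.compact
  refine ⟨continuous_avgL K hKc (continuous_avgR K hKc hf) ⟨C, norm_avgR_le K hKc f hC⟩, ?_⟩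
  exact HasCompactSupport.of_support_subset_isCompact (hKc.mul (hasCompactSupport_avgR K hKc hf))
    ((subset_tsupport _).trans (tsupport_avgL_subset K hKc (hasCompactSupport_avgR K hKc hf)))

/-- The two-sided average is supported in `K · (tsupport f · K)`. -/
theorem tsupport_avg_subset [T2Space G] (K : Subgroup G) (hKc : IsCompact (K : Set G)) {f : G → ℂ}
    (hf : IsTest f) : tsupport (avgL K hKc (avgR K hKc f)) ⊆ (K : Set G) * (tsupport f * (K : Set G)) :=
  (tsupport_avgL_subset K hKc (hasCompactSupport_avgR K hKc hf)).trans
    (Set.mul_subset_mul_left (tsupport_avgR_subset K hKc hf))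

/-- **The two-sided average is bi-`K`-invariant.** -/
theorem avg_invariant (K : Subgroup G) (hKc : IsCompact (K : Set G)) (f : G → ℂ) {k : G} (hk : k ∈ K) (x : G) :
    avgL K hKc (avgR K hKc f) (x * k) = avgL K hKc (avgR K hKc f) x ∧
      avgL K hKc (avgR K hKc f) (k * x) = avgL K hKc (avgR K hKc f) x :=
  ⟨avgL_right_invariant_of K hKc _ (fun _ hk' y => avgR_right_invariant K hKc f hk' y) hk x,
    avgL_left_invariant K hKc _ hk x⟩

/-- The right average is within `η` of `f` when `f` moves by at most `η` under right translation by `K`. -/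
theorem norm_avgR_sub_le (K : Subgroup G) (hKc : IsCompact (K : Set G)) {f : G → ℂ} (hf : IsTest f) {η : ℝ}
    (hη : ∀ x, ∀ k ∈ K, ‖f (x * k) - f x‖ ≤ η) (x : G) : ‖avgR K hKc f x - f x‖ ≤ η := by
  haveI := haarK_isProbabilityMeasure K hKc
  haveI : CompactSpace K := isCompact_iff_compactSpace.mp hKc
  have hint : Integrable (fun k : K => f (x * (k : G))) (haarK K hKc) :=
    (hf.cont.comp (continuous_const.mul continuous_subtype_val)).integrable_of_hasCompactSupport
      (HasCompactSupport.of_compactSpace _)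
  have hfx : f x = ∫ _k : K, f x ∂(haarK K hKc) := by simp
  rw [avgR, hfx, ← integral_sub hint (integrable_const _)]
  calc ‖∫ k : K, (f (x * (k : G)) - f x) ∂(haarK K hKc)‖
      ≤ ∫ k : K, ‖f (x * (k : G)) - f x‖ ∂(haarK K hKc) := norm_integral_le_integral_norm _
    _ ≤ ∫ _k : K, η ∂(haarK K hKc) := by
        apply integral_mono_of_nonneg (Eventually.of_forall fun _ => norm_nonneg _) (integrable_const _)
        exact Eventually.of_forall fun k => hη x k k.2
    _ = η := by simp

/-- The left average of a continuous `g` is within `η` of `g` when `g` moves by at most `η` under left translation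
by `K⁻¹`. -/
theorem norm_avgL_sub_le (K : Subgroup G) (hKc : IsCompact (K : Set G)) {g : G → ℂ} (hg : Continuous g) {η : ℝ}
    (hη : ∀ x, ∀ k ∈ K, ‖g (k⁻¹ * x) - g x‖ ≤ η) (x : G) : ‖avgL K hKc g x - g x‖ ≤ η := by
  haveI := haarK_isProbabilityMeasure K hKc
  haveI : CompactSpace K := isCompact_iff_compactSpace.mp hKc
  have hint : Integrable (fun k : K => g ((k : G)⁻¹ * x)) (haarK K hKc) :=
    (hg.comp (continuous_subtype_val.inv.mul continuous_const)).integrable_of_hasCompactSupport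
      (HasCompactSupport.of_compactSpace _)
  have hgx : g x = ∫ _k : K, g x ∂(haarK K hKc) := by simp
  rw [avgL, hgx, ← integral_sub hint (integrable_const _)]
  calc ‖∫ k : K, (g ((k : G)⁻¹ * x) - g x) ∂(haarK K hKc)‖
      ≤ ∫ k : K, ‖g ((k : G)⁻¹ * x) - g x‖ ∂(haarK K hKc) := norm_integral_le_integral_norm _
    _ ≤ ∫ _k : K, η ∂(haarK K hKc) := by
        apply integral_mono_of_nonneg (Eventually.of_forall fun _ => norm_nonneg _) (integrable_const _)
        exact Eventually.of_forall fun k => hη x k k.2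
    _ = η := by simp

/-- Left translation of the right average is controlled by left translation of `f`. -/
theorem norm_avgR_sub_avgR_le (K : Subgroup G) (hKc : IsCompact (K : Set G)) {f : G → ℂ} (hf : IsTest f)
    {u : G} {η : ℝ} (hη : ∀ y, ‖f (u * y) - f y‖ ≤ η) (x : G) :
    ‖avgR K hKc f (u * x) - avgR K hKc f x‖ ≤ η := by
  haveI := haarK_isProbabilityMeasure K hKc
  haveI : CompactSpace K := isCompact_iff_compactSpace.mp hKc
  have hint₁ : Integrable (fun k : K => f (u * x * (k : G))) (haarK K hKc) :=
    (hf.cont.comp (continuous_const.mul continuous_subtype_val)).integrable_of_hasCompactSupport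
      (HasCompactSupport.of_compactSpace _)
  have hint₂ : Integrable (fun k : K => f (x * (k : G))) (haarK K hKc) :=
    (hf.cont.comp (continuous_const.mul continuous_subtype_val)).integrable_of_hasCompactSupport
      (HasCompactSupport.of_compactSpace _)
  unfold avgR
  rw [← integral_sub hint₁ hint₂]
  calc ‖∫ k : K, (f (u * x * (k : G)) - f (x * (k : G))) ∂(haarK K hKc)‖
      ≤ ∫ k : K, ‖f (u * x * (k : G)) - f (x * (k : G))‖ ∂(haarK K hKc) := norm_integral_le_integral_norm _
    _ ≤ ∫ _k : K, η ∂(haarK K hKc) := by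
        apply integral_mono_of_nonneg (Eventually.of_forall fun _ => norm_nonneg _) (integrable_const _)
        exact Eventually.of_forall fun k => by
          show ‖f (u * x * (k : G)) - f (x * (k : G))‖ ≤ η
          rw [mul_assoc]
          exact hη _
    _ = η := by simp

omit [MeasurableSpace G] [BorelSpace G] in
/-- UNIFORM CONTINUITY under LEFT translation (the twin of t4-L1-p2's `IsTest.exists_nhds_norm_sub_lt`): for a test
function `f` and `η > 0` there is a neighbourhood `V` of `1` with `‖f (u g) − f g‖ < η` for all `g` and `u ∈ V`. -/
theorem IsTest.exists_nhds_norm_sub_lt_left {f : G → ℂ} (hf : IsTest f) {η : ℝ} (hη : 0 < η) :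
    ∃ V ∈ 𝓝 (1 : G), ∀ g : G, ∀ u ∈ V, ‖f (u * g) - f g‖ < η := by
  have hK : IsCompact (tsupport f) := hf.compact
  have h₁ : ∀ᶠ u in 𝓝 (1 : G), ∀ g ∈ tsupport f, ‖f (u * g) - f g‖ < η := by
    apply hK.eventually_forall_of_forall_eventually
    intro g _
    have hc : Continuous fun z : G × G => ‖f (z.1 * z.2) - f z.2‖ :=
      ((hf.cont.comp (continuous_fst.mul continuous_snd)).sub (hf.cont.comp continuous_snd)).norm
    have h0 : Tendsto (fun z : G × G => ‖f (z.1 * z.2) - f z.2‖) (𝓝 (1, g)) (𝓝 0) := by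
      simpa using hc.tendsto (1, g)
    exact h0.eventually (gt_mem_nhds hη)
  have h₂ : ∀ᶠ u in 𝓝 (1 : G), ∀ g ∈ tsupport f, ‖f (u⁻¹ * g) - f g‖ < η := by
    apply hK.eventually_forall_of_forall_eventually
    intro g _
    have hc : Continuous fun z : G × G => ‖f (z.1⁻¹ * z.2) - f z.2‖ :=
      ((hf.cont.comp (continuous_fst.inv.mul continuous_snd)).sub (hf.cont.comp continuous_snd)).norm
    have h0 : Tendsto (fun z : G × G => ‖f (z.1⁻¹ * z.2) - f z.2‖) (𝓝 (1, g)) (𝓝 0) := by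
      simpa using hc.tendsto (1, g)
    exact h0.eventually (gt_mem_nhds hη)
  refine ⟨_, h₁.and h₂, ?_⟩
  rintro g u ⟨hu₁, hu₂⟩
  by_cases hg : g ∈ tsupport f
  · exact hu₁ g hg
  · by_cases hgu : u * g ∈ tsupport f
    · have := hu₂ (u * g) hgu
      rw [inv_mul_cancel_left, norm_sub_rev] at this
      exact this
    · rw [image_eq_zero_of_notMem_tsupport hg, image_eq_zero_of_notMem_tsupport hgu, sub_zero, norm_zero]
      exact hη

end Average

end RTF

end Summit.Ventures.HodgeRepro.Tier4.Line1

end
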